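/-
Copyright (c) 2026 the pub-hodgecm-mathlib formalisation cell (harness21).  Prover seat hodgecm-mathlib-K2E1b-p08 (g0), Track B ∕ K2-LIT
(build stream 29), h413 = `stmt-HodgeConjecture-24833`, line `K2_E1b_GKCohomologyU21`, socket module «U0 TwistIntegration», file #10 — the payment of
`K2E1bGKCohomologyU21.U0.sig_K2E1bDatumCohUnitaryIrrep` TOKEN FOR TOKEN.  2026-09-03.
-/
import Summits.HodgeConjecture.HodgeConjecture.Theorems.K2E1bKTypeTwistDefs
import Summits.HodgeConjecture.HodgeConjecture.Theorems.K2E1bKovLieTwist        -- ★ #3 `kovLieTwist`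
import Summits.HodgeConjecture.HodgeConjecture.Theorems.K2E1bDatumTwistActs      -- ★ #4 `DatumTwistActs`
import Summits.HodgeConjecture.HodgeConjecture.Theorems.K2E1bKTypeTwistGK        -- ★ #5 `KTypeTwistGK`
import Summits.HodgeConjecture.HodgeConjecture.Theorems.K2E1bTwistAdmissible     -- ★ #6 `twistAdmissible`
import Summits.HodgeConjecture.HodgeConjecture.Theorems.K2E1bTwistChiScalars     -- ★ #7 `twistChiScalars`
import Summits.HodgeConjecture.HodgeConjecture.Theorems.K2E1bTwistHermitian      -- ★ #8 `twistHermitian`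
import Summits.HodgeConjecture.HodgeConjecture.Theorems.K2E1bTwistIrreducible    -- ★ #9 `TwistIrreducible`
import Summits.HodgeConjecture.HodgeConjecture.Theorems.F0P3bArchDegOnePackageDefs
import Summits.HodgeConjecture.HodgeConjecture.Theorems.F0P3bStubT3aUnitaryAlongPOfHermitian
import Literature.RepresentationTheory.BorelWallach2000.UpqCasimirTensor
import Literature.RepresentationTheory.Kovacevic2021.SU21Unitarity
import HarnessLib

/-!
# h413 ∕ Track B «K2-LIT», line `K2_E1b_GKCohomologyU21`, unit U0 «TWIST INTEGRATION», file #10: THE PER-DATUM PACKAGING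
# (payment of `Cruxes/H413/Lines/K2_E1b_GKCohomologyU21_U0_TwistIntegration.lean :: sig_K2E1bDatumCohUnitaryIrrep`, statement bytes frozen)

Cell `pub/hodgecm-mathlib`, crux H413 = `stmt-HodgeConjecture-24833`, route of record `HCCMUnconditional`; chair K2-lead (g0), dealer K2E1b-plan (g0),
EMIT «SKELETON LANDED K2E1b» (REQUESTS l.72387) file #10 `sig_K2E1bDatumCohUnitaryIrrep` (M; deps #3–#9) ↦ seat K2E1b-p08.
THEOREMS ONLY (no `def`, no `instance`, no `notation`, no named-fact hypothesis, no `sorry`); lane `--supports stmt-HodgeConjecture-24833 --as helper`.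

THE STATEMENT (bytes of the socket).  For every Kovačević datum `𝒟` (★ `SU21Datum`: a `𝔤𝔩(3, ℂ)`-module `𝒟.V = ⨁ V_{n,m}` on the `u`-basis
`u^k_{n,m}`, `(n, m) ∈ 𝒟.S`, `1 ≤ k ≤ n`), every `e : ℤ` and `κ₀ : ℂ`: if `𝒟.V` is irreducible, unitarizable (★ `IsUnitarizable`), the trace-form
Casimir `Σ_{ij} E_ij E_ji` acts by `κ₀`, and `6 ∣ m − 3n + 3 + 2e` on `𝒟.S`, then there are a `K`-action `ρK` and a real Lie homomorphism
`σ : 𝔲(2,1) → End 𝒟.V` with `σ` the central twist of `𝒟.ρ` by `e∕3` (`IsTwistOf`), `(ρK, σ)` an irreducible admissible `(𝔤, K)`-module unitary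
along `𝔭 ⊕ ℝz₀` (★ `IsCohUnitaryIrrep`), `upqCasimirOp σ = κ₀ + e²∕3`, and every `Z` with matrix `i·1` acting by `e·i`.

THE PROOF (strategy: ASSEMBLY of the unit — this file is the conjunction node of U0).  §1 `datumCohUnitaryIrrep_of` is the sorry-free GLUE: from the
seven sibling sockets of the unit, taken as hypotheses with their statement bytes VERBATIM — #3 `sig_K2E1bKovLieTwist` (the twist `σ` exists),
#4 `sig_K2E1bDatumTwistActs` (`σ|_𝔨` acts by the twisted `u`-basis formulas), #5 `sig_K2E1bKTypeTwistGK` (twisted `K`-integration: some `K`-type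
preserving `ρK` with `IsGKModule`), #6 `sig_K2E1bTwistAdmissible`, #7 `sig_K2E1bTwistChiScalars` (`κ₀ + e²∕3` and the centre clause),
#8 `sig_K2E1bTwistHermitian` (invariant Hermitian form) and #9 `sig_K2E1bTwistIrreducible` — plus ★ T3a `stubT3aUnitaryAlongPOfHermitian_holds`
(Hermitian form ⇒ `IsUnitaryAlongP`) and ★ `IsCohUnitaryIrrep.mk`, it derives the socket's conclusion.  The only datum-side inputs are
★ `SU21Datum.one_le_of_mem` (`1 ≤ n` on `𝒟.S`, feeding #5∕#6) and the reducible identifications `G21 = uFormGroup (Fin 2) (Fin 1)`,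
`𝒟.V = (KIdx 𝒟.S →₀ ℂ)` (★ `F0P3bKTypeIntegration` header).  §2 `DatumCohUnitaryIrrep` = the socket BY NAME, the glue applied to the landed
sibling theorems ★ `K2E1bKovLieTwist.kovLieTwist`, ★ `K2E1bDatumTwistActs.DatumTwistActs`, ★ `K2E1bKTypeTwistGK.KTypeTwistGK`,
★ `K2E1bTwistAdmissible.twistAdmissible`, ★ `K2E1bTwistChiScalars.twistChiScalars`, ★ `K2E1bTwistHermitian.twistHermitian`, ★ `K2E1bTwistIrreducible.TwistIrreducible`
(seats K2E1b-p01…p07) — one term, no tactic.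

HONEST LABEL.  HC_CM is proved only modulo the 7 printed citations (2 remaining named inputs: hLiu418 = `stmt-HodgeConjecture-24832`, h413 =
`stmt-HodgeConjecture-24833`) until rung 0 closes; this file moves no counter by itself (it packages U0 for the carriers `J^±_φ`, `D_φ`, `π²_φ` of
the tier-0 tables `stub_jTable` ∕ `stub_dsTable`).

## References
* [Rogawski1990] J. Rogawski, *Automorphic representations of unitary groups in three variables*, Ann. of Math. Stud. 123 (1990), §12.3 pp. 176–178
  (the modules `J^±_φ`, `D_φ`, `π²_φ` and their central∕infinitesimal characters), Prop. 13.8.1.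
* [BorelWallach2000] A. Borel, N. Wallach, *Continuous Cohomology, Discrete Subgroups, and Representations of Reductive Groups*, 2nd ed., AMS 2000 —
  0 §2.5 (admissible `(𝔤, K)`-modules), II §2.3 ∕ Prop. 6.12 (2) (Casimir), VI Thm. 4.12 (2) (unitarity of the cohomological modules of `SU(n,1)`).
* [Kovacevic2021] D. Kovačević, *Unitary `(𝔤, K)`-modules of `SU(2,1)`* (2021) — §3 Def. 1, Thm. 3 (the `K`-type modules, irreducibility), §4 Thm. 4
  (unitarizability).
-/

set_option autoImplicit false
-- the mandated namespace repeats the single-problem summit's segment (`HodgeConjecture.HodgeConjecture`)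
set_option linter.dupNamespace false

noncomputable section

namespace Summit.HodgeConjecture.HodgeConjecture.Cruxes.H413.K2E1bDatumCohUnitaryIrrep

open Literature.NumberTheory.Automorphic
open Literature.RepresentationTheory.BorelWallach2000
open Literature.RepresentationTheory.KonnoKonno2007 Literature.RepresentationTheory.KonnoKonno2007.RealDualPair
open Literature.RepresentationTheory.KonnoKonno2007.RealDualPair.UForm
open Literature.RepresentationTheory.Kovacevic2021 Literature.RepresentationTheory.Kovacevic2021.SU21Datum
open Summit.HodgeConjecture.HodgeConjecture.Cruxes.H413.F0P3bLocalAPacketsDefs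
open Summit.HodgeConjecture.HodgeConjecture.Cruxes.H413.F0P3bKTypeIntegration (KIdx kvec)
open Summit.HodgeConjecture.HodgeConjecture.Cruxes.H413.F0P3bArchDegOnePackage (IsCohUnitaryIrrep IsUnitaryAlongP)
open Summit.HodgeConjecture.HodgeConjecture.Cruxes.H413.F0P3bStubT3aUnitaryAlongPOfHermitian (stubT3aUnitaryAlongPOfHermitian_holds)
open Summit.HodgeConjecture.HodgeConjecture.Cruxes.H413.K2E1bGKCohomologyU21 (IsTwistOf ActsOnKTypesTwist)

-- Mathlib idiom (as in `GKModules`, the `Upq*` files, the Kovačević topic, the defs leaves and the socket module): commutator bracket on `Module.End` ∕ matrices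
attribute [local instance 100] LieRing.ofAssociativeRing

/-! ## §1 The glue: the socket from its seven sibling sockets (statement bytes of #3–#9 VERBATIM as hypotheses) + ★ T3a -/

/-- **GLUE (assembly node of unit U0).**  From the seven sibling sockets of `K2_E1b_GKCohomologyU21_U0_TwistIntegration` — in order: #3 the central
twist `σ` of every `𝔤𝔩(3, ℂ)`-module exists; #4 on a Kovačević datum `σ|_𝔨` acts by the twisted `u`-basis formulas; #5 twisted `K`-integration
(a `K`-type preserving `ρK` with `IsGKModule`); #6 admissibility; #7 the χ-scalars `κ₀ + e²∕3` ∕ `e·i`; #8 the invariant Hermitian form; #9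
irreducibility — and ★ T3a (`HasInvariantHermitianForm σ ⇒ IsUnitaryAlongP σ`), the per-datum package `IsCohUnitaryIrrep ρK σ` with its χ-scalars.
Pure logic over ★ `SU21Datum.one_le_of_mem` and the reducible identifications `G21 = U(2,1)`, `𝒟.V = (KIdx 𝒟.S →₀ ℂ)`.
[cite: Rogawski1990, §12.3 pp. 176–177] [cite: BorelWallach2000, VI Thm. 4.12 (2)] [cite: Kovacevic2021, §3 Thm. 3; §4 Thm. 4] -/
theorem datumCohUnitaryIrrep_of
    (h3 : ∀ (V : Type) [AddCommGroup V] [Module ℂ V] (ρ : Matrix (Fin 3) (Fin 3) ℂ →ₗ⁅ℂ⁆ Module.End ℂ V) (z : ℂ),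
      ∃ σ : G21.lie →ₗ⁅ℝ⁆ Module.End ℂ V, IsTwistOf ρ z σ)
    (h4 : ∀ (𝒟 : SU21Datum) (e : ℤ) (σ : G21.lie →ₗ⁅ℝ⁆ Module.End ℂ 𝒟.V),
      IsTwistOf 𝒟.ρ ((e : ℂ) / 3) σ → ActsOnKTypesTwist 𝒟.S e σ)
    (h5 : ∀ (S : Set (ℤ × ℤ)) (e : ℤ), (∀ n m : ℤ, (n, m) ∈ S → 1 ≤ n ∧ (6 : ℤ) ∣ m - 3 * n + 3 + 2 * e) →
      ∀ (ρ𝔤 : (uFormGroup (Fin 2) (Fin 1)).lie →ₗ⁅ℝ⁆ Module.End ℂ (KIdx S →₀ ℂ)), ActsOnKTypesTwist S e ρ𝔤 →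
        ∃ ρK : Representation ℂ (uFormGroup (Fin 2) (Fin 1)).maximalCompact (KIdx S →₀ ℂ),
          IsGKModule (uFormGroup (Fin 2) (Fin 1)) ρK ρ𝔤 ∧
            ∀ (g : (uFormGroup (Fin 2) (Fin 1)).maximalCompact) (n m k : ℤ),
              ρK g (kvec S n m k) ∈ Submodule.span ℂ (Set.range fun l : ℤ => kvec S n m l))
    (h6 : ∀ (S : Set (ℤ × ℤ)) (e : ℤ) (ρK : Representation ℂ (uFormGroup (Fin 2) (Fin 1)).maximalCompact (KIdx S →₀ ℂ))
      (ρ𝔤 : (uFormGroup (Fin 2) (Fin 1)).lie →ₗ⁅ℝ⁆ Module.End ℂ (KIdx S →₀ ℂ)),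
      (∀ n m : ℤ, (n, m) ∈ S → 1 ≤ n) → IsGKModule (uFormGroup (Fin 2) (Fin 1)) ρK ρ𝔤 → ActsOnKTypesTwist S e ρ𝔤 →
        (∀ (g : (uFormGroup (Fin 2) (Fin 1)).maximalCompact) (n m k : ℤ),
          ρK g (kvec S n m k) ∈ Submodule.span ℂ (Set.range fun l : ℤ => kvec S n m l)) →
        IsAdmissibleGK ρK)
    (h7 : ∀ (𝒟 : SU21Datum) (e : ℤ) (κ₀ : ℂ), (∀ v : 𝒟.V, (∑ i : Fin 3, ∑ j : Fin 3, ⁅E i j, ⁅E j i, v⁆⁆) = κ₀ • v) →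
      ∀ (σ : G21.lie →ₗ⁅ℝ⁆ Module.End ℂ 𝒟.V), IsTwistOf 𝒟.ρ ((e : ℂ) / 3) σ →
        (∀ v : 𝒟.V, upqCasimirOp σ v = (κ₀ + (e : ℂ) ^ 2 / 3) • v) ∧
          ∀ Z : G21.lie, (Z : Matrix (Fin 2 ⊕ Fin 1) (Fin 2 ⊕ Fin 1) ℂ) = Complex.I • (1 : Matrix (Fin 2 ⊕ Fin 1) (Fin 2 ⊕ Fin 1) ℂ) →
            ∀ v : 𝒟.V, σ Z v = ((e : ℂ) * Complex.I) • v)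
    (h8 : ∀ (𝒟 : SU21Datum) (e : ℤ) (σ : G21.lie →ₗ⁅ℝ⁆ Module.End ℂ 𝒟.V),
      IsTwistOf 𝒟.ρ ((e : ℂ) / 3) σ → IsUnitarizable 𝒟 → HasInvariantHermitianForm σ)
    (h9 : ∀ (𝒟 : SU21Datum) (e : ℤ) (σ : G21.lie →ₗ⁅ℝ⁆ Module.End ℂ 𝒟.V), IsTwistOf 𝒟.ρ ((e : ℂ) / 3) σ →
      LieModule.IsIrreducible ℂ (Matrix (Fin 3) (Fin 3) ℂ) 𝒟.V →
        ∀ ρK : Representation ℂ G21.maximalCompact 𝒟.V, IsGKModule G21 ρK σ → IsIrreducibleGK ρK σ) :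
    ∀ (𝒟 : SU21Datum) (e : ℤ) (κ₀ : ℂ), LieModule.IsIrreducible ℂ (Matrix (Fin 3) (Fin 3) ℂ) 𝒟.V → IsUnitarizable 𝒟 →
      (∀ v : 𝒟.V, (∑ i : Fin 3, ∑ j : Fin 3, ⁅E i j, ⁅E j i, v⁆⁆) = κ₀ • v) →
      (∀ n m : ℤ, (n, m) ∈ 𝒟.S → (6 : ℤ) ∣ m - 3 * n + 3 + 2 * e) →
        ∃ (ρK : Representation ℂ G21.maximalCompact 𝒟.V) (σ : G21.lie →ₗ⁅ℝ⁆ Module.End ℂ 𝒟.V),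
          IsTwistOf 𝒟.ρ ((e : ℂ) / 3) σ ∧ IsCohUnitaryIrrep ρK σ ∧
            (∀ v : 𝒟.V, upqCasimirOp σ v = (κ₀ + (e : ℂ) ^ 2 / 3) • v) ∧
              ∀ Z : G21.lie, (Z : Matrix (Fin 2 ⊕ Fin 1) (Fin 2 ⊕ Fin 1) ℂ) = Complex.I • (1 : Matrix (Fin 2 ⊕ Fin 1) (Fin 2 ⊕ Fin 1) ℂ) →
                ∀ v : 𝒟.V, σ Z v = ((e : ℂ) * Complex.I) • v := by
  intro 𝒟 e κ₀ hirr hunit hcas hdiv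
  -- #3: the central twist `σ` of `𝒟.ρ` by `e∕3`
  obtain ⟨σ, hσ⟩ := h3 𝒟.V 𝒟.ρ ((e : ℂ) / 3)
  -- #4: `σ|_𝔨` acts by the twisted `u`-basis formulas on Kovačević's basis
  have hacts : ActsOnKTypesTwist 𝒟.S e σ := h4 𝒟 e σ hσ
  -- #5: twisted `K`-integration (`1 ≤ n` on `𝒟.S` is ★ `SU21Datum.one_le_of_mem`; the divisibility is the hypothesis)
  have hS : ∀ n m : ℤ, (n, m) ∈ 𝒟.S → 1 ≤ n ∧ (6 : ℤ) ∣ m - 3 * n + 3 + 2 * e :=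
    fun n m h => ⟨𝒟.one_le_of_mem h, hdiv n m h⟩
  obtain ⟨ρK, hgk, hpres⟩ := h5 𝒟.S e hS σ hacts
  -- #6: admissibility of the `K`-type preserving `(𝔤, K)`-structure
  have hadm : IsAdmissibleGK ρK := h6 𝒟.S e ρK σ (fun n m h => 𝒟.one_le_of_mem h) hgk hacts hpres
  -- #7: the χ-scalars of the twist
  obtain ⟨hcasσ, hcentre⟩ := h7 𝒟 e κ₀ hcas σ hσ
  -- #8 + ★ T3a: unitarity along `𝔭 ⊕ ℝz₀`
  have hherm : HasInvariantHermitianForm σ := h8 𝒟 e σ hσ hunit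
  have hunitP : IsUnitaryAlongP σ := stubT3aUnitaryAlongPOfHermitian_holds (Fin 2) (Fin 1) 𝒟.V σ hherm
  -- #9: irreducibility of `(ρK, σ)`
  have hirrGK : IsIrreducibleGK ρK σ := h9 𝒟 e σ hσ hirr ρK hgk
  exact ⟨ρK, σ, hσ, ⟨hgk, hirrGK, hadm, hunitP⟩, hcasσ, hcentre⟩

/-! ## §2 The socket `sig_K2E1bDatumCohUnitaryIrrep`, token for token (the glue applied to the seven landed sibling theorems) -/

/-- **Socket #10 `sig_K2E1bDatumCohUnitaryIrrep` of `Cruxes/H413/Lines/K2_E1b_GKCohomologyU21_U0_TwistIntegration.lean` (statement bytes frozen).**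
An irreducible unitarizable Kovačević datum `𝒟` with constant trace-form Casimir `κ₀` and `6 ∣ m − 3n + 3 + 2e` on its `K`-types carries, for the
central twist `σ` of `𝒟.ρ` by `e∕3`, a `K`-action `ρK` making `(ρK, σ)` an irreducible admissible `(𝔲(2,1), K)`-module unitary along `𝔭 ⊕ ℝz₀`
(★ `IsCohUnitaryIrrep`) with χ-scalars `(κ₀ + e²∕3, e)`.  Proof: `datumCohUnitaryIrrep_of` at the seven sibling theorems of unit U0 —
★ `K2E1bKovLieTwist.kovLieTwist` (#3), ★ `K2E1bDatumTwistActs.DatumTwistActs` (#4), ★ `K2E1bKTypeTwistGK.KTypeTwistGK` (#5), ★ `K2E1bTwistAdmissible.twistAdmissible` (#6), ★ `K2E1bTwistChiScalars.twistChiScalars` (#7), ★ `K2E1bTwistHermitian.twistHermitian` (#8), ★ `K2E1bTwistIrreducible.TwistIrreducible` (#9).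
[cite: Rogawski1990, §12.3 pp. 176–177] [cite: BorelWallach2000, VI Thm. 4.12 (2)] [cite: Kovacevic2021, §3 Thm. 3; §4 Thm. 4] -/
theorem DatumCohUnitaryIrrep :
    ∀ (𝒟 : SU21Datum) (e : ℤ) (κ₀ : ℂ), LieModule.IsIrreducible ℂ (Matrix (Fin 3) (Fin 3) ℂ) 𝒟.V → IsUnitarizable 𝒟 →
      (∀ v : 𝒟.V, (∑ i : Fin 3, ∑ j : Fin 3, ⁅E i j, ⁅E j i, v⁆⁆) = κ₀ • v) →
      (∀ n m : ℤ, (n, m) ∈ 𝒟.S → (6 : ℤ) ∣ m - 3 * n + 3 + 2 * e) →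
        ∃ (ρK : Representation ℂ G21.maximalCompact 𝒟.V) (σ : G21.lie →ₗ⁅ℝ⁆ Module.End ℂ 𝒟.V),
          IsTwistOf 𝒟.ρ ((e : ℂ) / 3) σ ∧ IsCohUnitaryIrrep ρK σ ∧
            (∀ v : 𝒟.V, upqCasimirOp σ v = (κ₀ + (e : ℂ) ^ 2 / 3) • v) ∧
              ∀ Z : G21.lie, (Z : Matrix (Fin 2 ⊕ Fin 1) (Fin 2 ⊕ Fin 1) ℂ) = Complex.I • (1 : Matrix (Fin 2 ⊕ Fin 1) (Fin 2 ⊕ Fin 1) ℂ) →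
                ∀ v : 𝒟.V, σ Z v = ((e : ℂ) * Complex.I) • v :=
  datumCohUnitaryIrrep_of K2E1bKovLieTwist.kovLieTwist K2E1bDatumTwistActs.DatumTwistActs K2E1bKTypeTwistGK.KTypeTwistGK
    K2E1bTwistAdmissible.twistAdmissible K2E1bTwistChiScalars.twistChiScalars K2E1bTwistHermitian.twistHermitian
    K2E1bTwistIrreducible.TwistIrreducible

end Summit.HodgeConjecture.HodgeConjecture.Cruxes.H413.K2E1bDatumCohUnitaryIrrep

end
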